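import Literature.Probability.Percolation.QuadCrossingSpace

/-!
# Exact self-duality makes crossing probabilities continuous in the quad; uniqueness reduces to a dense family

Route `Summits/CriticalPhenomena/CardyFormulaZ2/Theses/CardyMeckeFlip`, crux `MeckeRigidity`
(item stmt-CriticalPhenomena-14826), line `registered`, stub `stub_crossingUniqueness` (helpers).

Two structural consequences of hypothesis (D) alone (exact self-duality of the law `P` on the
Schramm–Smirnov space `ℋ_ℂ` on crossing cylinders, via transposed quads), used to cut the
uniqueness stub down to convenient quads:

* **shape dependence** — `P(⊞_Q)` depends only on the carrier and the four sides of `Q`, not on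
  its parametrisation (`measure_crossedEvent_eq_of_carrier_eq_of_side_eq`): both `Q` and `Q'` are
  dual to the same cyclic transpose;
* **continuity** — `Q ↦ P(⊞_Q)` is continuous on `𝒬_ℂ` for the uniform metric
  (`continuous_measureReal_crossedEvent`): upper semicontinuity holds for EVERY finite law because
  `⊞_Q = ⋂ₙ V_{B(Q,1/(n+1))}` (a configuration is a closed set of quads), and (D) turns it into lower
  semicontinuity through the `1`-Lipschitz cyclic transposition `(s,t) ↦ Q(1-t,s)`;
* hence **uniqueness on a dense family of quads is uniqueness everywhere**
  (`crossingUniqueness_of_dense`, registered sub-goal of the item): two exactly self-dual laws that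
  agree on a dense set of quads agree on every quad.

No kernel / flip hypothesis is used.  The cyclic transpose is built inside the proofs (the tree's
`Quad.rot` lives in `QuadCrossingRot.lean`, whose import cone carries the unproved DKKMO fact and is
kept out of this route's Theorems files).
-/

noncomputable section

open scoped unitInterval ENNReal
open MeasureTheory Set Metric Filter Topology
open Literature.Probability.Percolation Literature.Probability.Percolation.QuadCrossing

namespace Summit.CriticalPhenomena.CardyFormulaZ2.Theorems.CardyMeckeFlip

variable {D : Set ℂ}

/-! ### The cyclic transpose `(s, t) ↦ Q(1 - t, s)` (existence, with the Lipschitz property) -/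

/-- **Cyclic transposes exist, `1`-Lipschitz in the quad**: every quad `Q` has a transpose `Qᵗ`
(same carrier, `∂ₖQᵗ = ∂ₖ₊₁Q`) such that every other quad `Q'` has a transpose within `dist Q Q'`
of `Qᵗ` — namely `(s,t) ↦ Q(1-t,s)` for both. [folklore] -/
theorem exists_cyclicTranspose_lipschitz (Q : Quad D) :
    ∃ Qt : Quad D, (Qt.carrier = Q.carrier ∧ Qt.side 0 = Q.side 1 ∧ Qt.side 1 = Q.side 2 ∧
      Qt.side 2 = Q.side 3 ∧ Qt.side 3 = Q.side 0) ∧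
      ∀ Q' : Quad D, ∃ Qt' : Quad D, (Qt'.carrier = Q'.carrier ∧ Qt'.side 0 = Q'.side 1 ∧
        Qt'.side 1 = Q'.side 2 ∧ Qt'.side 2 = Q'.side 3 ∧ Qt'.side 3 = Q'.side 0) ∧
        dist Qt Qt' ≤ dist Q Q' := by
  -- the construction, uniformly in the quad
  let rot : Quad D → Quad D := fun R =>
    { toFun := fun p => R (σ p.2, p.1)
      continuous_toFun := R.continuous_toFun.comp
        ((unitInterval.continuous_symm.comp continuous_snd).prodMk continuous_fst)
      injective_toFun := fun p q h => by
        have := R.injective_toFun h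
        simp only [Prod.mk.injEq, unitInterval.symm_inj] at this
        exact Prod.ext this.2 this.1
      range_subset := by
        rintro _ ⟨p, rfl⟩
        exact R.range_subset ⟨(σ p.2, p.1), rfl⟩ }
  have rot_apply : ∀ (R : Quad D) (p : I × I), rot R p = R (σ p.2, p.1) := fun _ _ => rfl
  have hT : ∀ R : Quad D, (rot R).carrier = R.carrier ∧ (rot R).side 0 = R.side 1 ∧
      (rot R).side 1 = R.side 2 ∧ (rot R).side 2 = R.side 3 ∧ (rot R).side 3 = R.side 0 := by
    intro R
    refine ⟨?_, ?_, ?_, ?_, ?_⟩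
    · refine subset_antisymm ?_ ?_
      · rintro _ ⟨p, rfl⟩; exact ⟨(σ p.2, p.1), rfl⟩
      · rintro _ ⟨p, rfl⟩
        refine ⟨(p.2, σ p.1), ?_⟩
        rw [rot_apply]
        simp only [unitInterval.symm_symm]
    · refine subset_antisymm ?_ ?_
      · rintro _ ⟨p, hp, rfl⟩
        exact ⟨(σ p.2, p.1), (show p.1 = 0 from hp), rfl⟩
      · rintro _ ⟨p, hp, rfl⟩
        refine ⟨(p.2, σ p.1), (show p.2 = 0 from hp), ?_⟩
        rw [rot_apply]
        simp only [unitInterval.symm_symm]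
    · refine subset_antisymm ?_ ?_
      · rintro _ ⟨p, hp, rfl⟩
        refine ⟨(σ p.2, p.1), ?_, rfl⟩
        show σ p.2 = 1
        rw [show p.2 = 0 from hp, unitInterval.symm_zero]
      · rintro _ ⟨p, hp, rfl⟩
        refine ⟨(p.2, σ p.1), ?_, ?_⟩
        · show σ p.1 = 0
          rw [show p.1 = 1 from hp, unitInterval.symm_one]
        · rw [rot_apply]
          simp only [unitInterval.symm_symm]
    · refine subset_antisymm ?_ ?_
      · rintro _ ⟨p, hp, rfl⟩
        exact ⟨(σ p.2, p.1), (show p.1 = 1 from hp), rfl⟩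
      · rintro _ ⟨p, hp, rfl⟩
        refine ⟨(p.2, σ p.1), (show p.2 = 1 from hp), ?_⟩
        rw [rot_apply]
        simp only [unitInterval.symm_symm]
    · refine subset_antisymm ?_ ?_
      · rintro _ ⟨p, hp, rfl⟩
        refine ⟨(σ p.2, p.1), ?_, rfl⟩
        show σ p.2 = 0
        rw [show p.2 = 1 from hp, unitInterval.symm_one]
      · rintro _ ⟨p, hp, rfl⟩
        refine ⟨(p.2, σ p.1), ?_, ?_⟩
        · show σ p.1 = 1
          rw [show p.1 = 0 from hp, unitInterval.symm_zero]
        · rw [rot_apply]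
          simp only [unitInterval.symm_symm]
  have hdist : ∀ R R' : Quad D, dist (rot R) (rot R') ≤ dist R R' := by
    intro R R'
    rw [Quad.dist_eq, ContinuousMap.dist_le dist_nonneg]
    intro p
    exact Quad.dist_apply_le R R' (σ p.2, p.1)
  exact ⟨rot Q, hT Q, fun Q' => ⟨rot Q', hT Q', hdist Q Q'⟩⟩

/-! ### (D) alone: duality with a transpose, shape dependence -/

/-- **(D) on one quad**: `P(⊞_Q) = 1 - P(⊞_{Qᵗ})` for every transpose `Qᵗ` of `Q`. [folklore] -/
theorem measure_crossedEvent_eq_one_sub_transpose (P : Measure (QuadConfig (univ : Set ℂ)))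
    [IsProbabilityMeasure P]
    (hD : ∀ (n : ℕ) (Q Qt : Fin n → Quad (univ : Set ℂ)),
      (∀ i, (Qt i).carrier = (Q i).carrier ∧ (Qt i).side 0 = (Q i).side 1 ∧
        (Qt i).side 1 = (Q i).side 2 ∧ (Qt i).side 2 = (Q i).side 3 ∧ (Qt i).side 3 = (Q i).side 0) →
      ∀ A : Set (Set (Fin n)), P {S | {i | Q i ∈ S} ∈ A} = P {S | {i | Qt i ∉ S} ∈ A})
    (Q Qt : Quad (univ : Set ℂ))
    (ht : Qt.carrier = Q.carrier ∧ Qt.side 0 = Q.side 1 ∧ Qt.side 1 = Q.side 2 ∧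
      Qt.side 2 = Q.side 3 ∧ Qt.side 3 = Q.side 0) :
    P (QuadConfig.crossedEvent Q) = 1 - P (QuadConfig.crossedEvent Qt) := by
  have key := hD 1 (fun _ => Q) (fun _ => Qt) (fun _ => ht) {T | (0 : Fin 1) ∈ T}
  have hL : {S : QuadConfig (univ : Set ℂ) | {i : Fin 1 | Q ∈ S} ∈ {T : Set (Fin 1) | (0 : Fin 1) ∈ T}}
      = QuadConfig.crossedEvent Q := by
    ext S; simp
  have hR : {S : QuadConfig (univ : Set ℂ) | {i : Fin 1 | Qt ∉ S} ∈ {T : Set (Fin 1) | (0 : Fin 1) ∈ T}}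
      = (QuadConfig.crossedEvent Qt)ᶜ := by
    ext S; simp
  rwa [hL, hR, prob_compl_eq_one_sub (QuadConfig.measurableSet_crossedEvent Qt)] at key

/-- Real form of `measure_crossedEvent_eq_one_sub_transpose`. [folklore] -/
theorem measureReal_crossedEvent_eq_one_sub_transpose (P : Measure (QuadConfig (univ : Set ℂ)))
    [IsProbabilityMeasure P]
    (hD : ∀ (n : ℕ) (Q Qt : Fin n → Quad (univ : Set ℂ)),
      (∀ i, (Qt i).carrier = (Q i).carrier ∧ (Qt i).side 0 = (Q i).side 1 ∧
        (Qt i).side 1 = (Q i).side 2 ∧ (Qt i).side 2 = (Q i).side 3 ∧ (Qt i).side 3 = (Q i).side 0) →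
      ∀ A : Set (Set (Fin n)), P {S | {i | Q i ∈ S} ∈ A} = P {S | {i | Qt i ∉ S} ∈ A})
    (Q Qt : Quad (univ : Set ℂ))
    (ht : Qt.carrier = Q.carrier ∧ Qt.side 0 = Q.side 1 ∧ Qt.side 1 = Q.side 2 ∧
      Qt.side 2 = Q.side 3 ∧ Qt.side 3 = Q.side 0) :
    P.real (QuadConfig.crossedEvent Q) = 1 - P.real (QuadConfig.crossedEvent Qt) := by
  have h := measure_crossedEvent_eq_one_sub_transpose P hD Q Qt ht
  simp only [Measure.real, h]
  rw [ENNReal.toReal_sub_of_le prob_le_one ENNReal.one_ne_top, ENNReal.toReal_one]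

/-- **Shape dependence under (D)**: two quads with the same carrier and the same four sides have
the same crossing probability (both are dual to one and the same cyclic transpose), for every
exactly self-dual probability law — no matter how they are parametrised. [folklore] -/
theorem measure_crossedEvent_eq_of_carrier_eq_of_side_eq (P : Measure (QuadConfig (univ : Set ℂ)))
    [IsProbabilityMeasure P]
    (hD : ∀ (n : ℕ) (Q Qt : Fin n → Quad (univ : Set ℂ)),
      (∀ i, (Qt i).carrier = (Q i).carrier ∧ (Qt i).side 0 = (Q i).side 1 ∧
        (Qt i).side 1 = (Q i).side 2 ∧ (Qt i).side 2 = (Q i).side 3 ∧ (Qt i).side 3 = (Q i).side 0) →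
      ∀ A : Set (Set (Fin n)), P {S | {i | Q i ∈ S} ∈ A} = P {S | {i | Qt i ∉ S} ∈ A})
    {Q Q' : Quad (univ : Set ℂ)} (hc : Q'.carrier = Q.carrier) (hs : ∀ k : Fin 4, Q'.side k = Q.side k) :
    P (QuadConfig.crossedEvent Q') = P (QuadConfig.crossedEvent Q) := by
  obtain ⟨Qt, ht, -⟩ := exists_cyclicTranspose_lipschitz Q
  have ht' : Qt.carrier = Q'.carrier ∧ Qt.side 0 = Q'.side 1 ∧ Qt.side 1 = Q'.side 2 ∧
      Qt.side 2 = Q'.side 3 ∧ Qt.side 3 = Q'.side 0 := by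
    rw [hc, hs 1, hs 2, hs 3, hs 0]; exact ht
  rw [measure_crossedEvent_eq_one_sub_transpose P hD Q Qt ht,
    measure_crossedEvent_eq_one_sub_transpose P hD Q' Qt ht']

/-! ### Upper semicontinuity of `Q ↦ P(⊞_Q)` for every finite law -/

/-- `⊞_Q = ⋂ₙ V_{B(Q, 1/(n+1))}`: a configuration crosses `Q` iff it crosses quads arbitrarily
close to `Q` (configurations are closed sets of quads). [folklore] -/
theorem crossedEvent_eq_iInter_someCrossed (Q : Quad D) :
    QuadConfig.crossedEvent Q = ⋂ n : ℕ, QuadConfig.someCrossed (ball Q (1 / ((n : ℝ) + 1))) := by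
  ext S
  simp only [QuadConfig.mem_crossedEvent, mem_iInter, QuadConfig.someCrossed, mem_setOf_eq]
  constructor
  · intro hQ n
    exact ⟨Q, hQ, mem_ball_self (by positivity)⟩
  · intro h
    have hcl : Q ∈ closure (S : Set (Quad D)) := by
      rw [Metric.mem_closure_iff]
      intro ε hε
      obtain ⟨n, hn⟩ := exists_nat_one_div_lt hε
      obtain ⟨Q', hQ'S, hQ'⟩ := h n
      exact ⟨Q', hQ'S, by rw [dist_comm]; exact (mem_ball.1 hQ').trans hn⟩
    rw [S.isClosed.closure_eq] at hcl
    exact hcl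

/-- The masses of the shrinking neighbourhood events `V_{B(Q,1/(n+1))}` decrease to `P(⊞_Q)`.
[folklore] -/
theorem tendsto_measure_someCrossed_ball (P : Measure (QuadConfig D)) [IsFiniteMeasure P]
    (Q : Quad D) :
    Tendsto (fun n : ℕ => P (QuadConfig.someCrossed (ball Q (1 / ((n : ℝ) + 1))))) atTop
      (𝓝 (P (QuadConfig.crossedEvent Q))) := by
  rw [crossedEvent_eq_iInter_someCrossed]
  refine tendsto_measure_iInter_atTop (fun n => ?_) (fun m n hmn => ?_) ⟨0, measure_ne_top P _⟩
  · exact (QuadConfig.isOpen_someCrossed isOpen_ball).measurableSet.nullMeasurableSet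
  · intro S hS
    obtain ⟨Q', hQ'S, hQ'⟩ := hS
    refine ⟨Q', hQ'S, ball_subset_ball ?_ hQ'⟩
    exact one_div_le_one_div_of_le (by positivity) (by exact_mod_cast Nat.succ_le_succ hmn)

/-- **Upper semicontinuity**: for every finite law and every quad `Q`, quads close to `Q` are
crossed with probability at most `P(⊞_Q) + ε`. [folklore] -/
theorem measureReal_crossedEvent_le_add_of_dist_lt (P : Measure (QuadConfig D)) [IsFiniteMeasure P]
    (Q : Quad D) {ε : ℝ} (hε : 0 < ε) :
    ∃ δ > 0, ∀ Q' : Quad D, dist Q' Q < δ →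
      P.real (QuadConfig.crossedEvent Q') ≤ P.real (QuadConfig.crossedEvent Q) + ε := by
  have h := (ENNReal.tendsto_toReal (measure_ne_top P (QuadConfig.crossedEvent Q))).comp
    (tendsto_measure_someCrossed_ball P Q)
  have hev : ∀ᶠ n : ℕ in atTop,
      (P (QuadConfig.someCrossed (ball Q (1 / ((n : ℝ) + 1))))).toReal <
        P.real (QuadConfig.crossedEvent Q) + ε :=
    h (Iio_mem_nhds (lt_add_of_pos_right _ hε))
  obtain ⟨n, hn⟩ := hev.exists
  refine ⟨1 / ((n : ℝ) + 1), by positivity, fun Q' hQ' => ?_⟩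
  have hsub : QuadConfig.crossedEvent Q' ⊆ QuadConfig.someCrossed (ball Q (1 / ((n : ℝ) + 1))) :=
    fun S hS => ⟨Q', hS, mem_ball.2 hQ'⟩
  calc P.real (QuadConfig.crossedEvent Q')
      ≤ P.real (QuadConfig.someCrossed (ball Q (1 / ((n : ℝ) + 1)))) :=
        measureReal_mono hsub (measure_ne_top P _)
    _ ≤ P.real (QuadConfig.crossedEvent Q) + ε := hn.le

/-! ### (D): continuity, and uniqueness from a dense family -/

/-- **Continuity of crossing probabilities under exact self-duality**: for an exactly self-dual
probability law on `ℋ_ℂ`, `Q ↦ P(⊞_Q)` is continuous on `𝒬_ℂ` (uniform metric): upper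
semicontinuity is free, and `P(⊞_Q) = 1 - P(⊞_{Qᵗ})` with the `1`-Lipschitz cyclic transpose
gives lower semicontinuity. [folklore] -/
theorem continuous_measureReal_crossedEvent (P : Measure (QuadConfig (univ : Set ℂ)))
    [IsProbabilityMeasure P]
    (hD : ∀ (n : ℕ) (Q Qt : Fin n → Quad (univ : Set ℂ)),
      (∀ i, (Qt i).carrier = (Q i).carrier ∧ (Qt i).side 0 = (Q i).side 1 ∧
        (Qt i).side 1 = (Q i).side 2 ∧ (Qt i).side 2 = (Q i).side 3 ∧ (Qt i).side 3 = (Q i).side 0) →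
      ∀ A : Set (Set (Fin n)), P {S | {i | Q i ∈ S} ∈ A} = P {S | {i | Qt i ∉ S} ∈ A}) :
    Continuous fun Q : Quad (univ : Set ℂ) => P.real (QuadConfig.crossedEvent Q) := by
  rw [Metric.continuous_iff]
  intro Q ε hε
  obtain ⟨Qt, ht, hlip⟩ := exists_cyclicTranspose_lipschitz Q
  obtain ⟨δ₁, hδ₁, h₁⟩ := measureReal_crossedEvent_le_add_of_dist_lt P Q (half_pos hε)
  obtain ⟨δ₂, hδ₂, h₂⟩ := measureReal_crossedEvent_le_add_of_dist_lt P Qt (half_pos hε)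
  refine ⟨min δ₁ δ₂, lt_min hδ₁ hδ₂, fun Q' hQ' => ?_⟩
  obtain ⟨Qt', ht', hd⟩ := hlip Q'
  have hup : P.real (QuadConfig.crossedEvent Q') ≤ P.real (QuadConfig.crossedEvent Q) + ε / 2 :=
    h₁ Q' (hQ'.trans_le (min_le_left _ _))
  have hQt' : dist Qt' Qt < δ₂ := by
    rw [dist_comm]
    exact hd.trans_lt ((dist_comm Q Q').symm ▸ hQ'.trans_le (min_le_right _ _))
  have hup' : P.real (QuadConfig.crossedEvent Qt') ≤ P.real (QuadConfig.crossedEvent Qt) + ε / 2 :=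
    h₂ Qt' hQt'
  have e₁ := measureReal_crossedEvent_eq_one_sub_transpose P hD Q Qt ht
  have e₂ := measureReal_crossedEvent_eq_one_sub_transpose P hD Q' Qt' ht'
  rw [Real.dist_eq, abs_lt]
  constructor <;> linarith

/-- **Uniqueness of crossing values from a dense family of quads** (registered sub-goal
`crossingUniqueness_of_dense` of item stmt-CriticalPhenomena-14826; support for
`stub_crossingUniqueness`): two exactly self-dual probability laws on `ℋ_ℂ` whose one-quad crossing
probabilities agree on a dense set of quads agree on every quad. [folklore] -/
theorem crossingUniqueness_of_dense : ∀ (P P' : Measure (QuadConfig (Set.univ : Set ℂ))), IsProbabilityMeasure P → IsProbabilityMeasure P' → (∀ (n : ℕ) (Q Qt : Fin n → Quad (Set.univ : Set ℂ)), (∀ i, (Qt i).carrier = (Q i).carrier ∧ (Qt i).side 0 = (Q i).side 1 ∧ (Qt i).side 1 = (Q i).side 2 ∧ (Qt i).side 2 = (Q i).side 3 ∧ (Qt i).side 3 = (Q i).side 0) → ∀ A : Set (Set (Fin n)), P {S | {i | Q i ∈ S} ∈ A} = P {S | {i | Qt i ∉ S} ∈ A}) → (∀ (n : ℕ) (Q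 Qt : Fin n → Quad (Set.univ : Set ℂ)), (∀ i, (Qt i).carrier = (Q i).carrier ∧ (Qt i).side 0 = (Q i).side 1 ∧ (Qt i).side 1 = (Q i).side 2 ∧ (Qt i).side 2 = (Q i).side 3 ∧ (Qt i).side 3 = (Q i).side 0) → ∀ A : Set (Set (Fin n)), P' {S | {i | Q i ∈ S} ∈ A} = P' {S | {i | Qt i ∉ S} ∈ A}) → ∀ A : Set (Quad (Set.univ : Set ℂ)), Dense A → (∀ Q ∈ A, P.real (QuadConfig.crossedEvent Q) = P'.real (QuadConfig.crossedEvent Q)) → ∀ Q : Quad (Set.univ : Set ℂ), P.real (QuadConfig.crossedEvent Q) = P'.real (QuadConfig.crossedEvent Q) := by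
  intro P P' hP hP' hD hD' A hA h Q
  have hf := continuous_measureReal_crossedEvent P hD
  have hg := continuous_measureReal_crossedEvent P' hD'
  exact congrFun (Continuous.ext_on hA hf hg fun Q hQ => h Q hQ) Q

end Summit.CriticalPhenomena.CardyFormulaZ2.Theorems.CardyMeckeFlip

end
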